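import Literature.Computability.FineGrained.SETHHardness
import Literature.Computability.FineGrained.CliqueETHTMBridge
import HarnessLib

/-!
# NSETH and the non-reducibility of CNF-SAT to 3SUM (Carmosino et al., ITCS 2016): decomposition

This file decomposes the named fact
`Literature.Computability.FineGrained.not_fgReducible_cnfSATWithSize_threeSUM_of_nseth`
(**fine-grained.S20**, `SETHHardness.lean`): assuming `NSETH`, for every `c ≥ 2` there is no
deterministic fine-grained reduction from `(CNFSATWithSize c, 2ⁿ)` to `(3SUM, n²)` — and proves
the assembly `not_fgReducible_cnfSATWithSize_threeSUM_of_nseth_of` from three named facts, two of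
them new and one already in the tree.

## The source

M. L. Carmosino, J. Gao, R. Impagliazzo, I. Mihajlin, R. Paturi, S. Schneider, *Nondeterministic
extensions of the Strong Exponential Time Hypothesis and consequences for non-reducibility*,
ITCS 2016. NSETH (§1 and Def. 1): for every `ε > 0` there is `k` with
`k`-TAUT ∉ `NTIME[2^{n(1-ε)}]`. Theorem 2 (§5): if NSETH holds and `C ∈ (N ∩ coN)TIME[T_C]`, then
`(SAT, 2ⁿ)` does not fine-grained reduce (deterministically; §3, Def. 1, after Vassilevska
Williams) to `(C, T_C^{1+γ})` for any `γ > 0` — by Corollary 1 (savings in `(N ∩ coN)TIME` are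
preserved along deterministic fine-grained reductions) such a reduction would put SAT in
`(N ∩ coN)TIME[2^{n(1-δ)}]`. Theorem 3 (§5, with the lemma of §5.5: `3-sum ∈ (N ∩ coN)TIME[Õ(n^{1.5})]`,
by guessing a prime `p ≤ p_{n^{1.5}}`, counting the three-sums modulo `p` by FFT and guessing the
`Õ(n^{1.5})` false positives): under NSETH there is no deterministic fine-grained reduction from SAT
to 3-sum with `T(n) = n^{1.5+γ}`, `γ > 0`. The vendored statement is the case `T(n) = n²`
(`= n^{1.5+0.5}`) for `CNFSATWithSize c`, `c ≥ 2`; it is implied by, and weaker than, the printed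
theorem.

## The machine models of the vendored statement, and the route taken here

`NSETH` (`SatAlgorithms.lean`) speaks about nondeterministic multi-stack Turing machines
(`KTAUTInNExpTime`: a `Turing.FinTM2` verifier over the alphabet `Bool`), whereas `FGReducible`
(`FGComplexity.lean`) speaks about deterministic word-RAM oracle programs run at word size
`k · width x`, `width x = inputWidth (encode x)` — for `CNFSATWithSize c` (encoding words
`≤ poly(n)`) these are `O(log n)`-bit words (VVW ICM 2018, §2: "`Θ(log n)`-bit words"). Two
consequences drive the decomposition.

* Along a run of the reduction with the canonical 3SUM oracle `threeSumOracle` (answers of length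
  one) every memory value, hence every address and every query length, is at most
  `V = max (2^{k · width x} - 1) (maxConst M) = poly(n)` (`WordRAM.run_memLE_of_queries`): the
  reduction has polynomial memory and its (up to `⌊C 2^{(1-δ)n} + C⌋` many) queries are 3SUM
  instances of polynomial size, each answerable by brute force in `poly(n)` steps. (In print a
  SETH-hardness reduction may write one query of size `2^{n/2}` — R. Williams' split-and-list for
  OV —, which `O(log n)`-bit words cannot address; in this model `(CNFSATWithSize c, 2ⁿ) ≤_FG (B, b)`
  is a demanding notion, and the present fact is correspondingly a weak — but faithful, see
  `SETHHardness.lean` — rendering of Theorem 3.) So the 3SUM-specific half of the printed proof,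
  the co-nondeterministic `Õ(n^{1.5})` algorithm of §5.5, is not needed for the threshold `n²`
  in this model: brute force inside the simulation suffices, and it is the *deterministic*
  savings for CNF-SAT that get transferred (Lemma 1 of the source rather than Corollary 1).
* The savings live on the word RAM and must be carried to multi-stack Turing machines at SETH
  granularity (`2^{(1-δ)n} ↦ 2^{(1-δ+η)n}`, every `η > 0`). With `poly(n)` memory this is the
  folklore simulation with polynomial overhead *per step* (Cook–Reckhow 1973, §2), the simulating
  machine answering the oracle queries itself by brute force; the interpreter of
  `WordRAMToTM2Interp.lean` (append-only memory log, cost polynomial in the *running time*) serves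
  ETH-type statements only (`sparseKSATInExpTime_of_liberalSparseKSATInRAMTime` is qualitative), so
  this step is a new named fact here, `sparseKSATInExpTime_of_cnfSATInThreeSumOracleRAMTime`.

The chain (all deterministic; NSETH enters only at the end, through `k`-TAUT ⊇ complement of `k`-SAT):

1. (`cnfSATInThreeSumOracleRAMTime_of_fgReducible`, proved) a fine-grained reduction
   `(CNFSATWithSize c, 2ⁿ) ≤_FG (3SUM, b)` (any `b`), taken at `ε = 1` with the oracle
   `threeSumOracle`, is a deterministic word-RAM *oracle* program deciding `CNFSATWithSize c` in
   `⌊C 2^{ρ n} + C⌋` steps for some `0 ≤ ρ < 1` (`CNFSATInThreeSumOracleRAMTime c ρ`);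
2. (`sparseKSATInExpTime_of_cnfSATInThreeSumOracleRAMTime`, NAMED FACT, the change of machine
   model with brute-force oracle answers) hence, for `c ≥ 2`, sparse `k`-SAT (`≤ c' n` clauses) is
   decided by multi-stack Turing machines in time `2^{(ρ+η)n} poly(L)` for all `k, c'`, `η > 0`
   (`SparseKSATInExpTime`, `CliqueETHTMBridge.lean`; the simulating machine pads `n` by a constant
   so that the clause list handed to the RAM lies in `CNFSATWithSize 2 ⊆ CNFSATWithSize c`);
3. (`kSATInExpTime_of_sparseKSATInExpTime_quantitative`, NAMED FACT, Impagliazzo–Paturi–Zane,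
   Cor. 2 in quantitative form, over the proved sparsification lemma `sparsification_holds`) hence
   `k`-SAT is in `TIME(2^{(ρ+η)n} poly(L))` for all `k` and `η > 0` (`KSATInExpTime`);
4. (`kTAUTInNExpTime_of_kSATInExpTime`, NAMED FACT of `SatAlgorithms.lean`) hence `k`-TAUT is in
   `NTIME(2^{(ρ+η)n} poly(L))` for all `k`, contradicting `NSETH` at `ε = (1-ρ)/2`.

Not here: the `(N ∩ coN)TIME` algorithms of §5 of the source (3SUM, APSP/ZWT, flows, matching),
Corollary 1 / Theorem 2 in their printed generality, and the APSP companion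
`not_fgReducible_cnfSATWithSize_apsp_of_nseth` (APSP is a function problem with long answers, for
which the polynomial-memory argument above fails).

## References

* M. L. Carmosino, J. Gao, R. Impagliazzo, I. Mihajlin, R. Paturi, S. Schneider, ITCS 2016, §1,
  Def. 1, §3 Def. 1, Lemma 1, Cor. 1, §5 Thm. 2–3, §5.5. [key `CarmosinoEtAlITCS2016`; held]
* V. Vassilevska Williams, *On some fine-grained questions in algorithms and complexity*,
  Proc. ICM 2018, §2 (word RAM, Def. 2.1, the remark after it). [key `VassilevskaWilliamsICM2018`]
* R. Impagliazzo, R. Paturi, F. Zane, JCSS 63 (2001), Thm. 1, Cor. 1–2.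
  [key `ImpagliazzoPaturiZaneJCSS2001`]
* S. A. Cook, R. A. Reckhow, *Time bounded random access machines*, JCSS 7 (1973), §2.
  [key `CookReckhow1973`]
-/

namespace Literature.Computability.FineGrained

open Cryptography Cryptography.WordRAM Complexity

/-! ### The canonical 3SUM oracle -/

/-- The canonical oracle for `threeSUM`: decode the queried word list by the inverse of the
zig-zag map `encodeInt = Equiv.intEquivNat` and answer `[1]` / `[0]` according to `HasThreeSum`.
It answers `threeSUM` on encodings of instances (`threeSUM_oracleAnswers_threeSumOracle`) and
returns *some* word list of length one on every other query (VVW ICM 2018, Def. 2.1: the oracle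
of a decision problem). [cite: VassilevskaWilliamsICM2018, §2 Def. 2.1] -/
def threeSumOracle (q : List ℕ) : List ℕ :=
  [if HasThreeSum (q.map Equiv.intEquivNat.symm) then 1 else 0]

/-- Every answer of the canonical 3SUM oracle has length one. [folklore] -/
@[simp] theorem length_threeSumOracle (q : List ℕ) : (threeSumOracle q).length = 1 := rfl

/-- Decoding an encoded integer list gives it back. [folklore] -/
theorem map_symm_encodeIntList (l : List ℤ) :
    (encodeIntList l).map Equiv.intEquivNat.symm = l := by
  simp [encodeIntList, encodeInt, List.map_map, Function.comp_def]

/-- The canonical oracle answers `threeSUM`: on the encoding of an instance `l` it returns the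
accepted output `[1]`/`[0]` of `threeSUM` (`threeSUM_good_iff`). [folklore] -/
theorem threeSUM_oracleAnswers_threeSumOracle : threeSUM.OracleAnswers threeSumOracle := by
  intro y
  rw [threeSUM_good_iff]
  show [if HasThreeSum ((encodeIntList y.1).map Equiv.intEquivNat.symm) then 1 else 0] = _
  rw [map_symm_encodeIntList]

/-! ### CNF-SAT with a polynomial clause budget on the word RAM with a 3SUM oracle -/

/-- `CNFSATInThreeSumOracleRAMTime c ρ`: some deterministic word-RAM *oracle* program `M`, run
with the canonical 3SUM oracle `threeSumOracle` at word size `k · inputWidth (encodeCNFWords φ)`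
(the word size of `FGReducible` on `CNFSATWithSize c`, i.e. `O(log n)`-bit words), halts on every
CNF `φ` with `numClauses φ + size φ ≤ (numVars φ + 1)ᶜ` (the instances of `CNFSATWithSize c`)
within `⌊C · 2^{ρ n} + C⌋₊` steps, `n = numVars φ`, with an accepted output of `CNFSAT` (`[1]` iff
`φ` is satisfiable). This is what a fine-grained reduction `(CNFSATWithSize c, 2ⁿ) ≤_FG (3SUM, b)`
delivers at a fixed `ε` (`cnfSATInThreeSumOracleRAMTime_of_fgReducible`), with nothing said about
the ledger of the queries: it is the hypothesis of the change of machine model below.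
(VVW ICM 2018, Def. 2.1; Carmosino et al. 2016, §3 Def. 1 and Lemma 1.)
[cite: VassilevskaWilliamsICM2018, §2 Def. 2.1] -/
def CNFSATInThreeSumOracleRAMTime (c : ℕ) (ρ : ℝ) : Prop :=
  ∃ (M : Program) (k : ℕ) (C : ℝ), M.IsDeterministic ∧
    ∀ φ : CNF ℕ, φ.numClauses + φ.size ≤ (φ.numVars + 1) ^ c →
      ∃ cfg : Cfg, HaltsWithin M (k * inputWidth (encodeCNFWords φ)) threeSumOracle zeroCoins
          (encodeCNFWords φ) ⌊C * (2 : ℝ) ^ (ρ * (φ.numVars : ℝ)) + C⌋₊ cfg ∧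
        readOut cfg.mem ∈ CNFSAT.Good φ

/-- Monotonicity of `CNFSATInThreeSumOracleRAMTime` in the exponent. [folklore] -/
theorem CNFSATInThreeSumOracleRAMTime.mono {c : ℕ} {ρ ρ' : ℝ}
    (h : CNFSATInThreeSumOracleRAMTime c ρ) (hρ : ρ ≤ ρ') : CNFSATInThreeSumOracleRAMTime c ρ' := by
  obtain ⟨M, k, C, hdet, hM⟩ := h
  refine ⟨M, k, max C 0, hdet, fun φ hφ => ?_⟩
  obtain ⟨cfg, hrun, hout⟩ := hM φ hφ
  refine ⟨cfg, hrun.mono (Nat.floor_le_floor ?_), hout⟩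
  have h0 : (0 : ℝ) ≤ max C 0 := le_max_right _ _
  have h1 : (0 : ℝ) ≤ (2 : ℝ) ^ (ρ * (φ.numVars : ℝ)) := by positivity
  have h2 : (2 : ℝ) ^ (ρ * (φ.numVars : ℝ)) ≤ (2 : ℝ) ^ (ρ' * (φ.numVars : ℝ)) :=
    Real.rpow_le_rpow_of_exponent_le (by norm_num)
      (mul_le_mul_of_nonneg_right hρ (Nat.cast_nonneg _))
  calc C * (2 : ℝ) ^ (ρ * (φ.numVars : ℝ)) + C
      ≤ max C 0 * (2 : ℝ) ^ (ρ * (φ.numVars : ℝ)) + max C 0 :=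
        add_le_add (mul_le_mul_of_nonneg_right (le_max_left _ _) h1) (le_max_left _ _)
    _ ≤ max C 0 * (2 : ℝ) ^ (ρ' * (φ.numVars : ℝ)) + max C 0 := by gcongr

/-- **Step 1 (proved): a fine-grained reduction to 3SUM is an exponential-time oracle program.**
If `(CNFSATWithSize c, 2ⁿ) ≤_FG (3SUM, b)` for some budget `b`, then — taking the reduction at
`ε = 1` and running it with the canonical oracle `threeSumOracle`, which answers `threeSUM` — some
deterministic oracle program decides `CNFSATWithSize c` within `⌊C 2^{ρ n} + C⌋₊` steps for an
exponent `0 ≤ ρ < 1` (`ρ = 1 - min δ 1` for the `δ` of the reduction). The ledger and the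
query-length charge of Def. 2.1 are simply forgotten. (Carmosino et al. 2016, Lemma 1: run the
reduction, simulating the oracle calls; VVW ICM 2018, remark after Def. 2.1.)
[cite: CarmosinoEtAlITCS2016, §3 Lemma 1] -/
theorem cnfSATInThreeSumOracleRAMTime_of_fgReducible {c : ℕ} {b : ℕ → ℝ}
    (h : FGReducible (CNFSATWithSize c) (fun n => (2 : ℝ) ^ (n : ℝ)) threeSUM b) :
    ∃ ρ : ℝ, 0 ≤ ρ ∧ ρ < 1 ∧ CNFSATInThreeSumOracleRAMTime c ρ := by
  obtain ⟨δ, hδ, M, k, C, hdet, hM⟩ := h 1 one_pos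
  refine ⟨1 - min δ 1, by have := min_le_right δ 1; linarith,
    by have := lt_min hδ one_pos; linarith, M, k, max C 0, hdet, fun φ hφ => ?_⟩
  obtain ⟨cfg, bs, hrun, hgood, -, -, -⟩ :=
    hM threeSumOracle threeSUM_oracleAnswers_threeSumOracle ⟨φ, hφ⟩
  refine ⟨cfg, hrun.mono (Nat.floor_le_floor ?_), hgood⟩
  -- `C (2ⁿ)^{1-δ} + C ≤ max C 0 · 2^{(1 - min δ 1) n} + max C 0`
  show C * ((2 : ℝ) ^ ((φ.numVars : ℕ) : ℝ)) ^ (1 - δ) + C ≤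
    max C 0 * (2 : ℝ) ^ ((1 - min δ 1) * (φ.numVars : ℝ)) + max C 0
  rw [← Real.rpow_mul (by norm_num : (0 : ℝ) ≤ 2)]
  have h0 : (0 : ℝ) ≤ max C 0 := le_max_right _ _
  have h1 : (0 : ℝ) ≤ (2 : ℝ) ^ ((φ.numVars : ℝ) * (1 - δ)) := by positivity
  have h2 : (2 : ℝ) ^ ((φ.numVars : ℝ) * (1 - δ)) ≤ (2 : ℝ) ^ ((1 - min δ 1) * (φ.numVars : ℝ)) := by
    refine Real.rpow_le_rpow_of_exponent_le (by norm_num) ?_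
    rw [mul_comm]
    exact mul_le_mul_of_nonneg_right (by have := min_le_left δ 1; linarith) (Nat.cast_nonneg _)
  calc C * (2 : ℝ) ^ ((φ.numVars : ℝ) * (1 - δ)) + C
      ≤ max C 0 * (2 : ℝ) ^ ((φ.numVars : ℝ) * (1 - δ)) + max C 0 :=
        add_le_add (mul_le_mul_of_nonneg_right (le_max_left _ _) h1) (le_max_left _ _)
    _ ≤ max C 0 * (2 : ℝ) ^ ((1 - min δ 1) * (φ.numVars : ℝ)) + max C 0 := by gcongr

/-! ### Step 2: the change of machine model, with brute-force oracle answers (named fact) -/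

/-- **Step 2 (named fact): from the word RAM with a 3SUM oracle to multi-stack Turing machines,
at SETH granularity.** For `c ≥ 2` and `ρ ≥ 0`: if some deterministic word-RAM oracle program
decides `CNFSATWithSize c` with the canonical 3SUM oracle in `⌊C 2^{ρ n} + C⌋₊` steps at word size
`k · inputWidth` (`CNFSATInThreeSumOracleRAMTime c ρ`), then for all `k'`, all densities `c'` and
all `η > 0` some multi-stack Turing machine decides the `k'`-CNFs with at most `c' n` clauses in
time `2^{(ρ+η)n} · poly(L)` (`SparseKSATInExpTime k' c' (ρ + η)`).
Why it holds (folklore; Cook–Reckhow 1973, §2: a random-access machine is simulated by a multitape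
Turing machine with polynomial overhead, here *per step* because the memory is polynomial): the
machine pads `numVars` by the constant `N = (k'+1) c' + 3` and hands the RAM the clause list with
one added tautological clause `x_{n+N-1} ∨ ¬x_{n+N-1}`, an instance of `CNFSATWithSize 2 ⊆
CNFSATWithSize c` on `n + N` variables with the same satisfiability; at word size
`w = k · inputWidth x = O(log n)` every value, address and query length of the oracle run is
`≤ V = max (2^w - 1) (maxConst M) = poly(n)` (`WordRAM.run_memLE_of_queries`, the oracle's answers
having length one), so the memory is kept as a table of `poly(n)` numerals of `O(log n)` bits, one
RAM step costs `poly(n)` Turing-machine steps, and each `query` is answered by the simulating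
machine itself, deciding `HasThreeSum` of the `≤ V` queried words by brute force in `poly(n)` steps;
the `≤ ⌊C 2^{ρ(n+N)} + C⌋₊ + 1` steps thus cost `2^{ρ n} · poly(n) ≤ C_η 2^{(ρ+η)n}` in all, plus
`poly(L)` for parsing. Compare `sparseKSATInExpTime_of_liberalSparseKSATInRAMTime`
(`CliqueETHTMBridge.lean`), the qualitative (ETH-granularity) version without oracle, proved in
`CliqueETHMachineModel.lean` with an interpreter whose cost is polynomial in the running time.
[cite: CookReckhow1973, §2] [cite: VassilevskaWilliamsICM2018, §2 (word RAM with O(log n)-bit words)] -/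
def sparseKSATInExpTime_of_cnfSATInThreeSumOracleRAMTime : Prop :=
  ∀ (c : ℕ) (ρ : ℝ), 2 ≤ c → 0 ≤ ρ → CNFSATInThreeSumOracleRAMTime c ρ →
    ∀ (k c' : ℕ) (η : ℝ), 0 < η → SparseKSATInExpTime k c' (ρ + η)

/-! ### Step 3: Corollary 2 of Impagliazzo–Paturi–Zane, quantitative form (named fact) -/

/-- **Step 3 (named fact): `k`-SAT from sparse `k`-SAT on Turing machines, keeping the exponent.**
For `ρ ≥ 0`: if for every density `c` and every `η > 0` the `k`-CNFs with at most `c n` clauses are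
decidable in time `2^{(ρ+η)n} · poly(L)` (`SparseKSATInExpTime k c (ρ + η)`), then `k`-SAT is
decidable in time `2^{(ρ+η)n} · poly(L)` for every `η > 0` (`KSATInExpTime k (ρ + η)`):
sparsify with `ε = η/3` (Impagliazzo–Paturi–Zane, JCSS 63 (2001), Thm. 1 / Cor. 1 — Wave0's
`sparsification`, PROVED as `sparsification_holds` in `SparsificationAlgorithm.lean`: at most
`2^{ε n}` formulas on the same `n` variables with `≤ C n` clauses each, in time `2^{ε n} poly(L)`),
decide each produced formula with the density-`C` machine of exponent `ρ + ε` (its input has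
length `O_{C,k}(n²)` and `poly(n) ≤ C' 2^{ε n}`), and accept iff one of them is accepted — Cor. 2
of Impagliazzo–Paturi–Zane (`k`-SAT SERF-reduces to sparse `k`-SAT), with the exponent bookkeeping
`ε + (ρ + ε) + ε = ρ + η` made explicit. The qualitative version (every `δ > 0` on sparse
instances gives every `δ > 0`) is the proved `kSATInExpTime_of_sparseKSATInExpTime` of
`CliqueETHTMBridge.lean`; the proof of this form is the same with `ρ` carried along.
[cite: ImpagliazzoPaturiZaneJCSS2001, Cor. 2 (with Thm. 1 / Cor. 1)] -/
def kSATInExpTime_of_sparseKSATInExpTime_quantitative : Prop :=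
  ∀ (k : ℕ) (ρ : ℝ), 0 ≤ ρ → (∀ (c : ℕ) (η : ℝ), 0 < η → SparseKSATInExpTime k c (ρ + η)) →
    ∀ η : ℝ, 0 < η → KSATInExpTime k (ρ + η)

/-! ### Assembly -/

/-- **Steps 2–4 assembled: a 3SUM-oracle program of exponent `ρ < 1` for `CNFSATWithSize c`,
`c ≥ 2`, refutes NSETH.** From `CNFSATInThreeSumOracleRAMTime c ρ` with `0 ≤ ρ < 1`: sparse
`k`-SAT, then `k`-SAT, then `k`-TAUT (nondeterministically, `kTAUTInNExpTime_of_kSATInExpTime`)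
have exponent `ρ + (1-ρ)/2 = 1 - (1-ρ)/2` for every `k`, contradicting `NSETH` at `ε = (1-ρ)/2`.
(Carmosino et al. 2016, proof of Thm. 2.) [cite: CarmosinoEtAlITCS2016, §5 Thm. 2 (proof)] -/
theorem not_nseth_of_cnfSATInThreeSumOracleRAMTime
    (h3 : sparseKSATInExpTime_of_cnfSATInThreeSumOracleRAMTime)
    (h4 : kSATInExpTime_of_sparseKSATInExpTime_quantitative)
    (h5 : kTAUTInNExpTime_of_kSATInExpTime)
    {c : ℕ} (hc : 2 ≤ c) {ρ : ℝ} (hρ0 : 0 ≤ ρ) (hρ1 : ρ < 1)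
    (hram : CNFSATInThreeSumOracleRAMTime c ρ) : ¬ NSETH := by
  intro hN
  have hη : 0 < (1 - ρ) / 2 := by linarith
  obtain ⟨k, -, hnot⟩ := hN ((1 - ρ) / 2) hη
  have hsat : KSATInExpTime k (ρ + (1 - ρ) / 2) :=
    h4 k ρ hρ0 (fun c' η hη' => h3 c ρ hc hρ0 hram k c' η hη') _ hη
  have e : ρ + (1 - ρ) / 2 = 1 - (1 - ρ) / 2 := by ring
  rw [e] at hsat
  exact hnot (h5 hsat)

/-- **Assembly (proved): the three named facts imply fine-grained.S20 verbatim.** Assuming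
`NSETH` and `c ≥ 2`, a fine-grained reduction `(CNFSATWithSize c, 2ⁿ) ≤_FG (3SUM, n²)` would give
(step 1) a 3SUM-oracle program of exponent `ρ < 1` for `CNFSATWithSize c`, hence (steps 2–4)
refute `NSETH`. This is Theorem 2/3 of Carmosino et al. for 3SUM at the threshold `n²`, in the
word-RAM / multi-stack-machine models of the tree. [cite: CarmosinoEtAlITCS2016, §5 Thm. 2–3] -/
theorem not_fgReducible_cnfSATWithSize_threeSUM_of_nseth_of
    (h3 : sparseKSATInExpTime_of_cnfSATInThreeSumOracleRAMTime)
    (h4 : kSATInExpTime_of_sparseKSATInExpTime_quantitative)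
    (h5 : kTAUTInNExpTime_of_kSATInExpTime) :
    not_fgReducible_cnfSATWithSize_threeSUM_of_nseth := by
  intro hN c hc hred
  obtain ⟨ρ, hρ0, hρ1, hram⟩ := cnfSATInThreeSumOracleRAMTime_of_fgReducible hred
  exact not_nseth_of_cnfSATInThreeSumOracleRAMTime h3 h4 h5 hc hρ0 hρ1 hram hN

/-- The same assembly for an arbitrary 3SUM budget `b` in place of `n²` (the argument never
inspects the ledger of the reduction: in this model no `(3SUM, b)` is SETH-hard under NSETH, for
`CNFSATWithSize c`, `c ≥ 2`). [cite: CarmosinoEtAlITCS2016, §5 Thm. 2–3] -/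
theorem not_fgReducible_cnfSATWithSize_threeSUM_budget_of
    (h3 : sparseKSATInExpTime_of_cnfSATInThreeSumOracleRAMTime)
    (h4 : kSATInExpTime_of_sparseKSATInExpTime_quantitative)
    (h5 : kTAUTInNExpTime_of_kSATInExpTime)
    (hN : NSETH) {c : ℕ} (hc : 2 ≤ c) (b : ℕ → ℝ) :
    ¬ FGReducible (CNFSATWithSize c) (fun n => (2 : ℝ) ^ (n : ℝ)) threeSUM b := by
  intro hred
  obtain ⟨ρ, hρ0, hρ1, hram⟩ := cnfSATInThreeSumOracleRAMTime_of_fgReducible hred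
  exact not_nseth_of_cnfSATInThreeSumOracleRAMTime h3 h4 h5 hc hρ0 hρ1 hram hN

end Literature.Computability.FineGrained
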